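import Mathlib
import Summits.NavierStokesRegularity.NavierStokesRegularity.Theorems.TaoLadderRungTwoBreakOneShiftWindowGridSlope
import Summits.NavierStokesRegularity.NavierStokesRegularity.Theorems.TaoLadderRungTwoBreakOneShiftWindowStepUpto
import HarnessLib

/-!
# The one-shift window system, XLV: THE GRID FOR RUNS ENDING INSIDE THE FINAL STEP — the C⁰ chain and the flow
# slope of part XL (`GridD.mem_start_of_grid`, `GridD.exists_flowSlope_of_grid`) for runs that solve the realisation's
# equations on `[0, T]` with `t_S ≤ T ≤ t_S + h_S` (the flight of a one-shift frame ends at the non-dyadic `τ_hi`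
# INSIDE the final dyadic step), plus the exact dyadic grid times `tD` the instance compares with the frame's flight
# box (cell harvest/h2-tao-ladder, seat p2; rung1/KERNEL-CHEAP-REPLAY-SPEC.md §2 (g)/(h), §8/§9; support for K1(1) =
# `NoSurvivingDSSOne`, stmt-NavierStokesRegularity-20205)

MODEL lattice ODEs only (Tao 2016 §4 normal form on Tao's shift set `S`); nothing here is a statement about
the Navier–Stokes equations; no item is closed; no instance is evaluated here. Generic in `ι`, `κ`.

* `GridD.tD`, `GridD.t_eq_toReal_tD` — the grid times as exact dyadics;
* `GridD.mem_start_of_grid'` — the C⁰ chain under `t_S ≤ T` only;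
* `GridD.exists_flowSlope_of_grid_upto` — all Booleans, runs on `[0, T]`, `T ∈ [t_S, t_S + h_S]`, `τ ∈ [t_S, T]` ⇒
  ONE real `U` with entries in `V_{S+1}` and `S_u(τ) − S_v(τ) = U (a − b)`, and both runs in the final hull `Hs_S` on
  `[t_S, T]` (part XLIV `PairStepD.sound_upto` on the final step).
-/

-- the sub-problem namespace repeats the summit name by design (D-0017)
set_option linter.dupNamespace false

namespace Summit.NavierStokesRegularity.NavierStokesRegularity.Theorems

namespace DSSOneShift

open Set Finset Metric Filter Topology TopologicalSpace
open Literature.Analysis.ODE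
open Summit.NavierStokesRegularity.NavierStokesRegularity.Theorems.TaylorModelCert
open Summit.NavierStokesRegularity.NavierStokesRegularity.Theorems.TaylorModelReadout
open Summit.NavierStokesRegularity.NavierStokesRegularity.Theorems.CertificateGlueOn

namespace GridD

variable (g : GridD)

/-! ### Exact dyadic grid times -/

/-- The grid time `t s` as an exact dyadic `Σ_{r<s} h_r`. [folklore] -/
def tD : ℕ → Dyad
  | 0 => Dyad.ofInt 0
  | s + 1 => (tD s).add (g.h s)

/-- The real grid time is the value of the dyadic one. [folklore] -/
theorem t_eq_toReal_tD (s : ℕ) : g.t s = (g.tD s).toReal := by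
  induction s with
  | zero => simp [tD]
  | succ s ih => rw [t_succ, ih]; simp [tD, Dyad.toReal_add]

/-! ### Soundness for runs ending inside the final step -/

section Sound

variable {ι : Type*} [Fintype ι] [DecidableEq ι] {κ : Type*} [Fintype κ]

/-- **THE C⁰ CHAIN under `t_S ≤ T`**: a run of a rough realisation from the first start box on `[0, T]`, `t_S ≤ T`,
with all step tests and link tests passed, is in the start box of every step at its grid time (part XXXIX
`mem_start_of_grid` uses only the regular steps, all of which end by `t_S`). [cite: Moore1979, §8.1 eq. (8.13) (continuation over steps); cell vocabulary, harvest/h2-tao-ladder rung1/KERNEL-CHEAP-REPLAY-SPEC.md §2 (h)] -/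
theorem mem_start_of_grid' (e : ι ≃ Fin g.n) (hn : ∀ s, (g.step s).n = g.n)
    {Tc : ℕ → κ → BTerm ι} {Tf : ℝ → κ → BTerm ι} {rows : ι → List κ}
    (hRDc : ∀ s ≤ g.S, IsRTEncl (g.es e hn s) (Tc s) (Tc s) rows (g.step s).RD)
    (hRD : ∀ s ≤ g.S, ∀ r ∈ Ico 0 (g.h s).toReal, IsRTEncl (g.es e hn s) (Tc s) (Tf (g.t s + r)) rows (g.step s).RD)
    (hstep : ∀ s ≤ g.S, g.stepOK s = true) (hlink : ∀ s < g.S, g.linkOK s = true)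
    {T : ℝ} (hT : g.t g.S ≤ T) {a : ι → ℝ} (ha : a ∈ boxSet (boxOf e (g.step 0).W))
    {Su : ℝ → ι → ℝ} (hSu0 : Su 0 = a)
    (hSu : ∀ t ∈ Icc 0 T, HasDerivWithinAt Su (termField (Tf t) (Su t)) (Icc 0 T) t) :
    ∀ s ≤ g.S, Su (g.t s) ∈ boxSet (boxOf e (g.step s).W) := by
  have hchk : ∀ s ≤ g.S, (g.step s).check = true := fun s hs => by
    have := hstep s hs
    simp only [stepOK, Bool.and_eq_true, decide_eq_true_eq] at this
    exact this.1
  have hh : ∀ s, s ≤ g.S → 0 ≤ (g.h s).toReal := fun s hs => by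
    have hc' : (g.step s).toRoughStepD.check = true ∧ (g.step s).checkPair = true := by
      simpa [PairStepD.check, Bool.and_eq_true] using hchk s hs
    have hrc' : (g.step s).toRoughStepD.centre.check = true ∧ (g.step s).toRoughStepD.checkKZ = true := by
      simpa [RoughStepD.check, Bool.and_eq_true] using hc'.1
    exact ((g.step s).toRoughStepD.centre.of_checkWith (by rw [← CentreStepD.check_eq]; exact hrc'.1)).2.1
  intro s
  induction s with
  | zero => intro _; simpa [hSu0] using ha
  | succ s ih =>
    intro hs
    have hs' : s < g.S := Nat.lt_of_succ_le hs
    have hmem := ih hs'.le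
    -- the re-clocked run on step `s`
    have hts0 : 0 ≤ g.t s := g.t_nonneg fun k hk => hh k (by omega)
    have htsT : g.t s + (g.h s).toReal ≤ T := by
      rw [← t_succ]
      exact (g.t_mono hs fun k hk => hh k hk.le).trans hT
    have hrun : ∀ r ∈ Icc 0 (g.h s).toReal,
        HasDerivWithinAt (fun r => Su (g.t s + r)) (termField (Tf (g.t s + r)) (Su (g.t s + r))) (Icc 0 (g.h s).toReal) r :=
      fun r hr => hasDerivWithinAt_shift (S := Su) (S' := fun t => termField (Tf t) (Su t)) hSu hts0 htsT hr
    have hc' : (g.step s).toRoughStepD.check = true := by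
      have : (g.step s).toRoughStepD.check = true ∧ (g.step s).checkPair = true := by
        simpa [PairStepD.check, Bool.and_eq_true] using hchk s hs'.le
      exact this.1
    have hmem' : Su (g.t s) ∈ boxSet (boxOf (g.es e hn s) (g.step s).W) := by rwa [boxOf_es]
    have hend := (g.step s).toRoughStepD.end_mem (g.es e hn s) (hRDc s hs'.le) (hRD s hs'.le) hc' hmem'
      (Su := fun r => Su (g.t s + r)) (by simp) hrun (tD := g.h s) ⟨hh s hs'.le, le_rfl⟩
    have hlk := g.of_linkOK (hlink s hs')
    rw [mem_boxSet_iff]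
    intro i
    have hi := hend i
    simp only [es_val] at hi
    have hsub := hlk (e i) (e i).isLt
    have := IntervalD.mem_of_subset hsub hi
    rw [t_succ]
    exact mem_toNI this

/-- **THE FLOW SLOPE OF THE GRID FOR RUNS ENDING INSIDE THE FINAL STEP.** All Booleans of the grid true; two runs of
the same rough realisation from `a, b ∈ W_0` that solve the equations on `[0, T]` with `t_S ≤ T ≤ t_S + h_S`; then
for every `τ ∈ [t_S, T]` there is ONE real `U` with entries in `V_{S+1}` and `S_u(τ) − S_v(τ) = U (a − b)`, and both
runs lie in the final hull `Hs_S` on `[t_S, T]`. [cite: Tao2016AveragedNS, §5.3; WalawskaWilczak2016, §2.2 Lemma 2; cell vocabulary, harvest/h2-tao-ladder rung1/KERNEL-CHEAP-REPLAY-SPEC.md §2 (g)/(h), §9] -/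
theorem exists_flowSlope_of_grid_upto (e : ι ≃ Fin g.n) (hn : ∀ s, (g.step s).n = g.n)
    {Tc : ℕ → κ → BTerm ι} {Tf : ℝ → κ → BTerm ι} {rows : ι → List κ}
    (hRDc : ∀ s ≤ g.S, IsRTEncl (g.es e hn s) (Tc s) (Tc s) rows (g.step s).RD)
    (hRD : ∀ s ≤ g.S, ∀ r ∈ Ico 0 (g.h s).toReal, IsRTEncl (g.es e hn s) (Tc s) (Tf (g.t s + r)) rows (g.step s).RD)
    (hstep : ∀ s ≤ g.S, g.stepOK s = true) (hlink : ∀ s < g.S, g.linkOK s = true) (hinit : g.initOK = true)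
    (hprod : ∀ s ≤ g.S, g.prodOK s = true)
    {T : ℝ} (hT : g.t g.S ≤ T) (hTS : T ≤ g.t g.S + (g.h g.S).toReal)
    {a b : ι → ℝ} (ha : a ∈ boxSet (boxOf e (g.step 0).W)) (hb : b ∈ boxSet (boxOf e (g.step 0).W))
    {Su Sv : ℝ → ι → ℝ} (hSu0 : Su 0 = a) (hSv0 : Sv 0 = b)
    (hSu : ∀ t ∈ Icc 0 T, HasDerivWithinAt Su (termField (Tf t) (Su t)) (Icc 0 T) t)
    (hSv : ∀ t ∈ Icc 0 T, HasDerivWithinAt Sv (termField (Tf t) (Sv t)) (Icc 0 T) t) :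
    (∀ τ ∈ Icc (g.t g.S) T, ∃ U : Matrix ι ι ℝ,
      (∀ i l, (g.Vent (g.S + 1) (e i) (e l)).lo.toReal ≤ U i l ∧ U i l ≤ (g.Vent (g.S + 1) (e i) (e l)).hi.toReal) ∧
      Su τ - Sv τ = U.mulVec (a - b)) ∧
    (∀ τ ∈ Icc (g.t g.S) T, Su τ ∈ boxSet (boxOf e (g.step g.S).Hs) ∧ Sv τ ∈ boxSet (boxOf e (g.step g.S).Hs)) := by
  classical
  have hchk : ∀ s ≤ g.S, (g.step s).check = true := fun s hs => by
    have := hstep s hs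
    simp only [stepOK, Bool.and_eq_true, decide_eq_true_eq] at this
    exact this.1
  have hh : ∀ s, s ≤ g.S → 0 ≤ (g.h s).toReal := fun s hs => by
    have hc' : (g.step s).toRoughStepD.check = true ∧ (g.step s).checkPair = true := by
      simpa [PairStepD.check, Bool.and_eq_true] using hchk s hs
    have hrc' : (g.step s).toRoughStepD.centre.check = true ∧ (g.step s).toRoughStepD.checkKZ = true := by
      simpa [RoughStepD.check, Bool.and_eq_true] using hc'.1
    exact ((g.step s).toRoughStepD.centre.of_checkWith (by rw [← CentreStepD.check_eq]; exact hrc'.1)).2.1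
  -- start boxes along the grid
  have hWu := g.mem_start_of_grid' e hn hRDc hRD hstep hlink hT ha hSu0 hSu
  have hWv := g.mem_start_of_grid' e hn hRDc hRD hstep hlink hT hb hSv0 hSv
  -- grid times
  have ht0 : ∀ s ≤ g.S, 0 ≤ g.t s := fun s hs => g.t_nonneg fun k hk => hh k (by omega)
  have htT : ∀ s < g.S, g.t s + (g.h s).toReal ≤ T := fun s hs => by
    rw [← t_succ]
    exact (g.t_mono (Nat.succ_le_of_lt hs) fun k hk => hh k hk.le).trans hT
  -- the re-clocked runs on a regular step
  have hrunU : ∀ s < g.S, ∀ r ∈ Icc 0 (g.h s).toReal,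
      HasDerivWithinAt (fun r => Su (g.t s + r)) (termField (Tf (g.t s + r)) (Su (g.t s + r))) (Icc 0 (g.h s).toReal) r :=
    fun s hs r hr => hasDerivWithinAt_shift (S := Su) (S' := fun t => termField (Tf t) (Su t)) hSu (ht0 s hs.le) (htT s hs) hr
  have hrunV : ∀ s < g.S, ∀ r ∈ Icc 0 (g.h s).toReal,
      HasDerivWithinAt (fun r => Sv (g.t s + r)) (termField (Tf (g.t s + r)) (Sv (g.t s + r))) (Icc 0 (g.h s).toReal) r :=
    fun s hs r hr => hasDerivWithinAt_shift (S := Sv) (S' := fun t => termField (Tf t) (Sv t)) hSv (ht0 s hs.le) (htT s hs) hr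
  -- the re-clocked runs on the final step, up to `τ'` for any `τ' ≤ T − t_S`
  have hfinU : ∀ τ' ∈ Icc 0 (T - g.t g.S), ∀ r ∈ Icc 0 τ',
      HasDerivWithinAt (fun r => Su (g.t g.S + r)) (termField (Tf (g.t g.S + r)) (Su (g.t g.S + r))) (Icc 0 τ') r :=
    fun τ' hτ' r hr => hasDerivWithinAt_shift (S := Su) (S' := fun t => termField (Tf t) (Su t)) hSu (ht0 g.S le_rfl)
      (by linarith [hτ'.2]) hr
  have hfinV : ∀ τ' ∈ Icc 0 (T - g.t g.S), ∀ r ∈ Icc 0 τ',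
      HasDerivWithinAt (fun r => Sv (g.t g.S + r)) (termField (Tf (g.t g.S + r)) (Sv (g.t g.S + r))) (Icc 0 τ') r :=
    fun τ' hτ' r hr => hasDerivWithinAt_shift (S := Sv) (S' := fun t => termField (Tf t) (Sv t)) hSv (ht0 g.S le_rfl)
      (by linarith [hτ'.2]) hr
  have hauS : Su (g.t g.S) ∈ boxSet (boxOf (g.es e hn g.S) (g.step g.S).W) := by rw [boxOf_es]; exact hWu g.S le_rfl
  have hbvS : Sv (g.t g.S) ∈ boxSet (boxOf (g.es e hn g.S) (g.step g.S).W) := by rw [boxOf_es]; exact hWv g.S le_rfl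
  -- the final step up to `τ − t_S`
  have hfinal : ∀ τ ∈ Icc (g.t g.S) T,
      (∃ U : Matrix ι ι ℝ,
        (∀ i j, ((g.step g.S).toRoughStepD.centre.vv (g.es e hn g.S i) (g.es e hn g.S j)).lo.toReal - (g.step g.S).cZh (g.es e hn g.S) i j ≤ U i j ∧
          U i j ≤ ((g.step g.S).toRoughStepD.centre.vv (g.es e hn g.S i) (g.es e hn g.S j)).hi.toReal + (g.step g.S).cZh (g.es e hn g.S) i j) ∧
        Su τ - Sv τ = U.mulVec (Su (g.t g.S) - Sv (g.t g.S))) ∧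
      (Su τ ∈ boxSet (boxOf e (g.step g.S).Hs) ∧ Sv τ ∈ boxSet (boxOf e (g.step g.S).Hs)) := by
    intro τ hτ
    have hτ' : τ - g.t g.S ∈ Icc 0 (g.h g.S).toReal := ⟨by linarith [hτ.1], by linarith [hτ.2, hTS]⟩
    have hτ'' : τ - g.t g.S ∈ Icc 0 (T - g.t g.S) := ⟨by linarith [hτ.1], by linarith [hτ.2]⟩
    obtain ⟨⟨U, hU, hrep⟩, hH⟩ := (g.step g.S).sound_upto (g.es e hn g.S) (hRDc g.S le_rfl) (hRD g.S le_rfl)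
      (hchk g.S le_rfl) hauS hbvS hτ' (Su := fun r => Su (g.t g.S + r)) (Sv := fun r => Sv (g.t g.S + r))
      (by simp) (by simp) (hfinU _ hτ'') (hfinV _ hτ'')
    have e1 : g.t g.S + (τ - g.t g.S) = τ := by ring
    refine ⟨⟨U, hU, by simpa [e1] using hrep⟩, ?_⟩
    have hH' := hH (τ - g.t g.S) ⟨hτ''.1, le_rfl⟩
    simp only [e1, boxOf_es] at hH'
    exact hH'
  refine ⟨fun τ hτ => ?_, fun τ hτ => (hfinal τ hτ).2⟩
  -- real boxes of the step slopes and of the products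
  let lo : ℕ → Matrix ι ι ℝ := fun s => Matrix.of fun i j => (g.Aent s (e i) (e j)).lo.toReal
  let hi : ℕ → Matrix ι ι ℝ := fun s => Matrix.of fun i j => (g.Aent s (e i) (e j)).hi.toReal
  let Ulo : Matrix ι ι ℝ := Matrix.of fun i j => (g.Vent (g.S + 1) (e i) (e j)).lo.toReal
  let Uhi : Matrix ι ι ℝ := Matrix.of fun i j => (g.Vent (g.S + 1) (e i) (e j)).hi.toReal
  -- per-step slopes on the regular steps
  have hslope : ∀ s < g.S, ∃ U : Matrix ι ι ℝ,
      (∀ i j, lo s i j ≤ U i j ∧ U i j ≤ hi s i j) ∧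
      Su (g.t s + (g.h s).toReal) - Sv (g.t s + (g.h s).toReal) = U.mulVec (Su (g.t s) - Sv (g.t s)) := by
    intro s hs
    have hau : Su (g.t s) ∈ boxSet (boxOf (g.es e hn s) (g.step s).W) := by rw [boxOf_es]; exact hWu s hs.le
    have hbv : Sv (g.t s) ∈ boxSet (boxOf (g.es e hn s) (g.step s).W) := by rw [boxOf_es]; exact hWv s hs.le
    obtain ⟨U, hU, hrep⟩ := (g.step s).sound (g.es e hn s) (hRDc s hs.le) (hRD s hs.le) (hchk s hs.le) hau hbv
      (Su := fun r => Su (g.t s + r)) (Sv := fun r => Sv (g.t s + r)) (by simp) (by simp) (hrunU s hs) (hrunV s hs)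
    refine ⟨U, fun i j => ?_, hrep⟩
    have h1 := hU i j
    have h2 := g.Aent_toReal e hn s i j
    simp only [lo, hi, Matrix.of_apply]
    rw [h2.1, h2.2]
    exact h1
  -- part XX
  refine exists_gridSlope Su Sv g.t g.t_zero g.S τ lo hi (lo g.S) (hi g.S) Ulo Uhi ?_ ?_ ?_ |>.imp fun U hU => ?_
  · intro s hs
    obtain ⟨U, hU, hrep⟩ := hslope s hs
    exact ⟨U, hU, by rw [t_succ]; exact hrep⟩
  · obtain ⟨U, hU, hrep⟩ := (hfinal τ hτ).1
    refine ⟨U, fun i j => ?_, hrep⟩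
    have h1 := hU i j
    have h2 := g.Aent_toReal e hn g.S i j
    simp only [lo, hi, Matrix.of_apply]
    rw [h2.1, h2.2]
    exact h1
  · -- the product enclosure
    intro Us UB hUs hUB
    have hP : ∀ k ≤ g.S, ∀ i l, IntervalD.mem ((((List.range k).map Us).reverse.prod) i l) (g.Vent k (e i) (e l)) := by
      intro k hk
      induction k with
      | zero => simpa using g.mem_Vent_zero e hinit
      | succ k ih =>
        have e1 : ((List.range (k + 1)).map Us).reverse.prod = Us k * ((List.range k).map Us).reverse.prod := by
          rw [List.range_succ, List.map_append, List.reverse_append, List.prod_append]; simp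
        rw [e1]
        exact g.mem_Vent_succ e (hprod k (by omega)) (fun i j => by
          have := hUs k (by omega) i j; simp only [lo, hi, Matrix.of_apply] at this; exact this) (ih (by omega))
    have hfin := g.mem_Vent_succ e (hprod g.S le_rfl) (M := UB) (fun i j => by
      have := hUB i j; simp only [lo, hi, Matrix.of_apply] at this; exact this) (hP g.S le_rfl)
    intro i j
    simp only [Ulo, Uhi, Matrix.of_apply]
    exact ⟨(hfin i j).1, (hfin i j).2⟩
  · obtain ⟨hU1, hU2⟩ := hU
    refine ⟨fun i l => ?_, by rw [hU2, hSu0, hSv0]⟩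
    have := hU1 i l
    simp only [Ulo, Uhi, Matrix.of_apply] at this
    exact this

end Sound

end GridD

end DSSOneShift

end Summit.NavierStokesRegularity.NavierStokesRegularity.Theorems
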